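import Summits.BirchSwinnertonDyer.BirchSwinnertonDyer.Theorems.UniversalToricDescentSigmaLocalFinite
import Summits.BirchSwinnertonDyer.BirchSwinnertonDyer.Theorems.UniversalToricDescentTowerNoPTorsionTwin
import HarnessLib

/-!
# Route UniversalToricDescent — the ALGEBRAIC HALF of act D's ♭T `DefectTransportModThree` in the
# direction act D needs, `E → E′`: from `X_{∅,0}(E/K_∞)` torsion with a generator of norm profile `n`
# to torsion, `μ = 0`, a generator of profile `λ_alg(E′)` for the TWIN, and
# `n + Σ_{v∈Σ} 3^{c_v}·s_v(E) = λ_alg(E′) + Σ_{v∈Σ} 3^{c_v}·s_v(E′)`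

Lead prover bsd-wall-utd-p1 g11 (`--supports`; pen pss3x g3 act D = GO 2026-08-28T05:16Z, PLAN-D.md /
SketchD.lean: crux #2's transport becomes the IMC-free ♭T `DefectTransportModThree`, whose twin side is
no longer assumed — the twin's Howard half is DROPPED, so every algebraic fact about `X_{∅,0}(E′/K_∞)`
must now be TRANSPORTED FROM THE WILD CURVE `E`). The tree's assemblies of the algebraic half
(`invariantsTransportT_algebraicHalf[_local/_lambda]`, g7/g8) run in the opposite direction (source = the
twin's frame `(L′, n′)`, target = `E`); the engines underneath are symmetric in `(W, W′)`
(`pow_lambdaInvariant_mul_natCard_baseChange_eq_of_modPCongruent`, `modPCongruent_symm`,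
`natCard_quotient_pTorsion_baseChange_eq_prod_of_noPTorsionPadic`), and this file re-assembles them with
SOURCE = `E`. A pleasant feature of this direction: hypothesis (iv) `E(ℚ₃)[3] = 0` is used for `E` itself
at the strict place `𝔭′` (`noFixedPTorsion_kerSubgroup_inf_decomp_of_noPTorsionPadic`), no transport of
(iv) to the twin is needed in the torsion step.

Binders: those of ♭T (`E/ℚ` of Kodaira class O6 at `3` — wild, `3 ∣ N` so `3` splits in the Heegner
field `K`; `E′` a mod-`3` congruent curve; `K` imaginary quadratic, Heegner for `N` and `N′`; `κ`
anticyclotomic with topological generator `γ`; `𝔭′ ∋ 3`), plus the SOURCE data «`X_{∅,0}(E)` torsion,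
`Ch·R₀⟦T⟧ = (g)`, `profile_n(g)`» (in ♭T: torsion is a hypothesis; `μ(g) = 0` comes from the wall
inclusion `(𝓛_E) ⊆ Ch` once `μ(𝓛_E) = 0` is known — that `μ` input is the analytic congruence's job).

* `defectTransport_algebraicHalf` — with (iv) and the no-finite-submodule properties (N1) for `E`, `E′`:
  `X_{∅,0}(E′)` torsion ∧ `∃ g′, Ch(E′)·R₀⟦T⟧ = (g′) ∧ profile_{λ_alg(E′)}(g′)` ∧
  `3^{n} · #(Sel^Σ/Sel^∅)(E)[3] = 3^{λ_alg(E′)} · #(Sel^Σ/Sel^∅)(E′)[3]`, `Σ = {v ∤ 3 : E_K or E′_K bad}`.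
* `defectTransport_algebraicHalf_local` — (N1) discharged from Poitou–Tate ×2 (named facts, leaves
  20461/20462) and base finiteness at `v ∣ 3` for `E` and `E′`; the two finite indices replaced by the local
  products `∏_{v∈Σ} (#H¹(kerD κ v, ·[3^∞])[3])^{3^{c_v}}` (GV Cor. (2.3) + (2.10) over `K_∞`).
* (sequel `UniversalToricDescentDefectTransportLambda`: the additive λ-currency
  `n + Σ_{v∈Σ} 3^{c_v} s_v(E) = λ_alg(E′) + Σ_{v∈Σ} 3^{c_v} s_v(E′)` and the rank-one discharge of `E`'s base
  finiteness.)

WHAT ♭T STILL NEEDS after this (honest): the ANALYTIC half — `Σ`-depleted anticyclotomic `3`-adic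
L-functions of `f_E`, `f_{E′}` congruent modulo `𝔪` with `λ(𝓛^Σ) = λ(𝓛) + Σ_v 3^{c_v} d_v` and
`d_v = s_v` (algebraic `s_v = d_v` is landed), which also supplies `μ(𝓛_E) = 0`; unprinted at `27 ∣ N`.
Residual algebraic inputs: Poitou–Tate ×2; (iv) (false on the 206 split-type classes with `E(ℚ₃)[3] ≠ 0`);
the twin's base finiteness. THEOREMS ONLY; no definition, no named fact, no `sorry`. BSD is not advanced by
this file. References: [GreenbergVatsal2000] Thm. (1.4), §2 Cor. (2.3), Prop. (2.4), (2.8), (2.10)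
(pp. 23–28); [Brink2007] Thm. 2, Cor. 1; [JetchevSkinnerWan2017] §3.2–3.3; [MilneADT2006] I Thm. 4.10.
-/

set_option autoImplicit false
-- `…BirchSwinnertonDyer.BirchSwinnertonDyer.Theorems…` is the problem's mandated namespace (D-0017).
set_option linter.dupNamespace false

noncomputable section

open scoped Classical

namespace Summit.BirchSwinnertonDyer.BirchSwinnertonDyer.Theorems.UniversalToricDescentDefectTransport

open Function Field NumberField IsDedekindDomain WeierstrassCurve
open Literature.NumberTheory.GaloisRepresentations Literature.NumberTheory.EllipticCurves
  Literature.NumberTheory.EllipticCurves.GreenbergSelmer Literature.NumberTheory.GaloisCohomology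
  Literature.NumberTheory.EllipticCurves.IwasawaAlgebra Literature.NumberTheory.EllipticCurves.Rank1Residual
  Summit.BirchSwinnertonDyer.Rank1Residual Summit.BirchSwinnertonDyer.Rank1Residual.X11b
  Summit.BirchSwinnertonDyer.Rank1Residual.X11b.Coinv Summit.BirchSwinnertonDyer.Rank1Residual.X11b.AcSelmer
  Summit.BirchSwinnertonDyer.Rank1Residual.X11b.LocBridge Summit.BirchSwinnertonDyer.Rank1Residual.X11b.H2Support
  Summit.BirchSwinnertonDyer.Rank1Residual.X11b.Levels Summit.BirchSwinnertonDyer.Rank1Residual.Iwasawa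
  Summit.BirchSwinnertonDyer.BirchSwinnertonDyer.Theorems.UniversalToricDescentSigmaCoinvariants
  Summit.BirchSwinnertonDyer.BirchSwinnertonDyer.Theorems.UniversalToricDescentSigmaLocalStabilizer
  Summit.BirchSwinnertonDyer.BirchSwinnertonDyer.Theorems.UniversalToricDescentSigmaFree
  Summit.BirchSwinnertonDyer.BirchSwinnertonDyer.Theorems.UniversalToricDescentSigmaPassage
  Summit.BirchSwinnertonDyer.BirchSwinnertonDyer.Theorems.UniversalToricDescentAcDualMuZero
  Summit.BirchSwinnertonDyer.BirchSwinnertonDyer.Theorems.UniversalToricDescentNoFiniteSubmodule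
  Summit.BirchSwinnertonDyer.BirchSwinnertonDyer.Theorems.UniversalToricDescentStrictPlace
  Summit.BirchSwinnertonDyer.BirchSwinnertonDyer.Theorems.UniversalToricDescentLambdaNormProfile
  Summit.BirchSwinnertonDyer.BirchSwinnertonDyer.Theorems.UniversalToricDescentInvariantsTransportT
  Summit.BirchSwinnertonDyer.BirchSwinnertonDyer.Theorems.UniversalToricDescentTorsionMuTransportHeegner
  Summit.BirchSwinnertonDyer.BirchSwinnertonDyer.Theorems.UniversalToricDescentSigmaLocalImage
  Summit.BirchSwinnertonDyer.BirchSwinnertonDyer.Theorems.UniversalToricDescentTowerTorsion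

/-- **Algebraic half of ♭T, direction `E → E′`, assembled.** Source: `X_{∅,0}(E/K_∞)` torsion with
`Ch·R₀⟦T⟧ = (g)`, `profile_n(g)`; with (iv) `E(ℚ₃)[3] = 0` and (N1) for `E`, `E′`: the twin's
`X_{∅,0}(E′/K_∞)` is torsion, its characteristic ideal has a generator with norm profile `λ_alg(E′)`, and
`3^{n} · #(Sel^Σ/Sel^∅)(E)[3] = 3^{λ_alg(E′)} · #(Sel^Σ/Sel^∅)(E′)[3]` at `Σ = {v ∤ 3 : E_K or E′_K bad}`
(finite, finitely decomposed in `K_∞` by Heegner + Brink). Chain: `μ(X_E) = 0`, `λ_alg(E) = n` from the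
profile; `Sel^∅[3]`, `Sel^Σ[3]` of `E` finite; (L) at `𝔭′` for `E` from (iv); the `Σ`-free transport along
`E[3] ≅ E′[3]` (`modPCongruent_symm`). [cite: GreenbergVatsal2000, Thm. (1.4), §2 Prop. (2.8) and (2.10) (pp. 26–28)]
[cite: Brink2007, Thm. 2 and Cor. 1] [cite: Castella2018Erratum, Lemma 2.1] -/
theorem defectTransport_algebraicHalf (W W' : WeierstrassCurve ℚ) [W.IsElliptic]
    [W.IsGloballyMinimal] [W'.IsElliptic] {N N' : ℕ} (K : Type) [Field K] [NumberField K]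
    (hO6 : Additive.ClassO6 W 3) (hN : W.conductorNorm ℤ = N) (hcong : O6.ModPCongruent W' W 3)
    (hN' : W'.conductorNorm ℤ = N') (hK : IsImaginaryQuadratic K)
    (hHe : SatisfiesHeegnerHypothesis N K) (hHe' : SatisfiesHeegnerHypothesis N' K)
    (κ : ZpExtension K 3) (hκ : κ.IsAnticyclotomic) (γ : absoluteGaloisGroup K)
    [Fact (κ.IsTopGenerator γ)] {𝔭' : HeightOneSpectrum (𝓞 K)} (h𝔭' : ((3 : ℕ) : 𝓞 K) ∈ 𝔭'.asIdeal)
    (hT : Module.IsTorsion (IwasawaAlgebra 3) (XAc (W.baseChange K) 3 κ 𝔭' ∅ γ))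
    {g : UnrSeries 3} {n : ℕ}
    (hg : (XAc.charIdeal (W.baseChange K) 3 κ 𝔭' ∅ γ).map (PowerSeries.map (Halves.toUnr 3)) =
      Ideal.span {g})
    (hn : (∀ i < n, ‖((PowerSeries.coeff i g : unrIntegers 3) : ℂ_[3])‖ < 1) ∧
      ‖((PowerSeries.coeff n g : unrIntegers 3) : ℂ_[3])‖ = 1)
    (h4 : ∀ R : (W.baseChange ℚ_[3]).toAffine.Point, 3 • R = 0 → R = 0)
    (hnf : ∀ M : Submodule (IwasawaAlgebra 3) (XAc (W.baseChange K) 3 κ 𝔭' ∅ γ), Finite M → M = ⊥)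
    (hnf' : ∀ M : Submodule (IwasawaAlgebra 3) (XAc (W'.baseChange K) 3 κ 𝔭' ∅ γ), Finite M → M = ⊥) :
    Module.IsTorsion (IwasawaAlgebra 3) (XAc (W'.baseChange K) 3 κ 𝔭' ∅ γ) ∧
      ∃ g' : UnrSeries 3,
        (XAc.charIdeal (W'.baseChange K) 3 κ 𝔭' ∅ γ).map (PowerSeries.map (Halves.toUnr 3)) =
            Ideal.span {g'} ∧
          (∀ i < lambdaInvariant 3 (XAc (W'.baseChange K) 3 κ 𝔭' ∅ γ),
            ‖((PowerSeries.coeff i g' : unrIntegers 3) : ℂ_[3])‖ < 1) ∧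
          ‖((PowerSeries.coeff (lambdaInvariant 3 (XAc (W'.baseChange K) 3 κ 𝔭' ∅ γ)) g' :
            unrIntegers 3) : ℂ_[3])‖ = 1 ∧
          3 ^ n *
              Nat.card {b : selmerAc (W.baseChange K) 3 κ 𝔭'
                  {v | ((3 : ℕ) : 𝓞 K) ∉ v.asIdeal ∧ (¬ (W.baseChange K).HasGoodReductionAt v ∨
                    ¬ (W'.baseChange K).HasGoodReductionAt v)} ⧸
                (selmerAc (W.baseChange K) 3 κ 𝔭' ∅).addSubgroupOf
                  (selmerAc (W.baseChange K) 3 κ 𝔭'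
                    {v | ((3 : ℕ) : 𝓞 K) ∉ v.asIdeal ∧ (¬ (W.baseChange K).HasGoodReductionAt v ∨
                      ¬ (W'.baseChange K).HasGoodReductionAt v)}) // 3 • b = 0} =
            3 ^ lambdaInvariant 3 (XAc (W'.baseChange K) 3 κ 𝔭' ∅ γ) *
              Nat.card {b : selmerAc (W'.baseChange K) 3 κ 𝔭'
                  {v | ((3 : ℕ) : 𝓞 K) ∉ v.asIdeal ∧ (¬ (W.baseChange K).HasGoodReductionAt v ∨
                    ¬ (W'.baseChange K).HasGoodReductionAt v)} ⧸
                (selmerAc (W'.baseChange K) 3 κ 𝔭' ∅).addSubgroupOf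
                  (selmerAc (W'.baseChange K) 3 κ 𝔭'
                    {v | ((3 : ℕ) : 𝓞 K) ∉ v.asIdeal ∧ (¬ (W.baseChange K).HasGoodReductionAt v ∨
                      ¬ (W'.baseChange K).HasGoodReductionAt v)}) // 3 • b = 0} := by
  haveI : Fact (Nat.Prime 3) := ⟨Nat.prime_three⟩
  -- `Σ` := the places prime to `3` where one of the two curves has bad reduction
  set S : Set (HeightOneSpectrum (𝓞 K)) := {v | ((3 : ℕ) : 𝓞 K) ∉ v.asIdeal ∧
    (¬ (W.baseChange K).HasGoodReductionAt v ∨ ¬ (W'.baseChange K).HasGoodReductionAt v)} with hSdef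
  have hSfin : S.Finite := by
    refine (((W.baseChange K).finite_badPlaces_holds (𝓞 K)).union
      ((W'.baseChange K).finite_badPlaces_holds (𝓞 K))).subset fun v hv ↦ ?_
    rcases hv.2 with h | h
    · exact Or.inl h
    · exact Or.inr h
  have hSp : ∀ v ∈ S, ((3 : ℕ) : 𝓞 K) ∉ v.asIdeal := fun v hv ↦ hv.1
  have hSdec : ∀ v ∈ S, ¬ (decomp v ≤ κ.kerSubgroup) := by
    intro v hv
    rcases hv.2 with h | h
    · exact not_decomp_le_kerSubgroup_of_not_hasGoodReductionAt_baseChange W hN K hK hHe (by decide) κ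
        hκ hv.1 h
    · exact not_decomp_le_kerSubgroup_of_not_hasGoodReductionAt_baseChange W' hN' K hK hHe' (by decide)
        κ hκ hv.1 h
  have hgood : ∀ v : HeightOneSpectrum (𝓞 K), v ∉ S → ((3 : ℕ) : 𝓞 K) ∉ v.asIdeal →
      (W.baseChange K).HasGoodReductionAt v := fun v hv hpv ↦ by
    by_contra h
    exact hv ⟨hpv, Or.inl h⟩
  have hgood' : ∀ v : HeightOneSpectrum (𝓞 K), v ∉ S → ((3 : ℕ) : 𝓞 K) ∉ v.asIdeal →
      (W'.baseChange K).HasGoodReductionAt v := fun v hv hpv ↦ by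
    by_contra h
    exact hv ⟨hpv, Or.inr h⟩
  -- the wild curve: `μ = 0` and `λ = n` at `Σ = ∅`, then torsion + `μ = 0` at `Σ`
  haveI := XAc.module_finite κ 𝔭' (∅ : Set (HeightOneSpectrum (𝓞 K))) γ Set.finite_empty
    (W := W.baseChange K)
  have hμe : muInvariant 3 (XAc (W.baseChange K) 3 κ 𝔭' ∅ γ) = 0 :=
    muInvariant_eq_zero_of_map_charIdeal_eq_span (XAc (W.baseChange K) 3 κ 𝔭' ∅ γ) hT hg ⟨n, hn.2⟩
  have hlam : lambdaInvariant 3 (XAc (W.baseChange K) 3 κ 𝔭' ∅ γ) = n :=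
    lambdaInvariant_eq_of_generator_normProfile (W.baseChange K) 3 κ 𝔭' ∅ γ Set.finite_empty hT hμe
      hg hn
  have hfine : Set.Finite {s : selmerAc (W.baseChange K) 3 κ 𝔭' ∅ | 3 • s = 0} :=
    finite_pTorsion_of_muInvariant_eq_zero (W.baseChange K) 3 κ 𝔭' ∅ γ hT hμe
  have hfinS : Set.Finite {s : selmerAc (W.baseChange K) 3 κ 𝔭' S | 3 • s = 0} :=
    finite_selmerAc_pTorsion_of_empty (W.baseChange K) κ hSfin hSp hSdec hfine
  have hTS : Module.IsTorsion (IwasawaAlgebra 3) (XAc (W.baseChange K) 3 κ 𝔭' S γ) :=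
    isTorsion_of_finite_pTorsion (W.baseChange K) 3 κ 𝔭' S γ hSfin hfinS
  have hμS : muInvariant 3 (XAc (W.baseChange K) 3 κ 𝔭' S γ) = 0 :=
    muInvariant_eq_zero_of_finite_pTorsion (W.baseChange K) 3 κ 𝔭' S γ hSfin hfinS
  -- (L) at the strict place `𝔭′` (degree one) from (iv), for the wild curve ITSELF
  obtain ⟨he', hf'⟩ := degreeOne_otherPrime_three hO6 hN hK hHe h𝔭'
  have hL := noFixedPTorsion_kerSubgroup_inf_decomp_of_noPTorsionPadic W 3 h4 κ h𝔭' he' hf'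
  -- the `Σ`-free transport, source `E`, target `E′`
  obtain ⟨-, ⟨hT', hμ'⟩, hcount⟩ :=
    pow_lambdaInvariant_mul_natCard_baseChange_eq_of_modPCongruent W' W K κ γ (by decide) h𝔭' hSfin
      hgood' hgood (modPCongruent_symm 3 W W' hcong) hL hTS hμS hnf hnf'
  -- the twin's generator with profile `λ_alg(E′)`
  obtain ⟨g', hg', hglt', hgeq'⟩ :=
    exists_generator_normProfile_lambdaInvariant (W'.baseChange K) 3 κ 𝔭' ∅ γ Set.finite_empty hT' hμ'
  refine ⟨hT', g', hg', hglt', hgeq', ?_⟩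
  rw [← hlam]
  exact hcount.symm

/-- **Algebraic half of ♭T, direction `E → E′`, LOCALISED**: (N1) for both curves from Poitou–Tate ×2
and base finiteness at `v ∣ 3`; the finite indices `#(Sel^Σ/Sel^∅)[3]` replaced by the local products
`∏_{v∈Σ} (#H¹(kerD κ v, ·[3^∞])[3])^{3^{c_v}}` (`3^{c_v}` = number of places of `K_∞` above `v`, exact index
`κ(D_v) = 3^{c_v}ℤ₃`): `3^{n} · ∏_v (#H¹(kerD κ v, E[3^∞])[3])^{3^{c_v}} = 3^{λ_alg(E′)} · ∏_v (…E′…)^{3^{c_v}}`.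
[cite: GreenbergVatsal2000, Thm. (1.4), §2 Cor. (2.3), Prop. (2.4), (2.8), (2.10) (pp. 23–28)]
[cite: JetchevSkinnerWan2017, Lemma 3.3.3 (arXiv:1512.06894 pp. 11–12)] [cite: MilneADT2006, Ch. I, Thm. 4.10] -/
theorem defectTransport_algebraicHalf_local (W W' : WeierstrassCurve ℚ) [W.IsElliptic]
    [W.IsGloballyMinimal] [W'.IsElliptic] [W'.IsGloballyMinimal] {N N' : ℕ} (K : Type) [Field K]
    [NumberField K]
    (hO6 : Additive.ClassO6 W 3) (hN : W.conductorNorm ℤ = N) (hcong : O6.ModPCongruent W' W 3)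
    (hN' : W'.conductorNorm ℤ = N') (hK : IsImaginaryQuadratic K)
    (hHe : SatisfiesHeegnerHypothesis N K) (hHe' : SatisfiesHeegnerHypothesis N' K)
    (κ : ZpExtension K 3) (hκ : κ.IsAnticyclotomic) (γ : absoluteGaloisGroup K)
    [Fact (κ.IsTopGenerator γ)] {𝔭' : HeightOneSpectrum (𝓞 K)} (h𝔭' : ((3 : ℕ) : 𝓞 K) ∈ 𝔭'.asIdeal)
    (hT : Module.IsTorsion (IwasawaAlgebra 3) (XAc (W.baseChange K) 3 κ 𝔭' ∅ γ))
    {g : UnrSeries 3} {n : ℕ}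
    (hg : (XAc.charIdeal (W.baseChange K) 3 κ 𝔭' ∅ γ).map (PowerSeries.map (Halves.toUnr 3)) =
      Ideal.span {g})
    (hn : (∀ i < n, ‖((PowerSeries.coeff i g : unrIntegers 3) : ℂ_[3])‖ < 1) ∧
      ‖((PowerSeries.coeff n g : unrIntegers 3) : ℂ_[3])‖ = 1)
    (h4 : ∀ R : (W.baseChange ℚ_[3]).toAffine.Point, 3 • R = 0 → R = 0)
    (hPT : poitouTate_selmerStructure_duality K) (hPT2 : poitouTate_sha_tateDual K)
    (hfin : ∀ v : HeightOneSpectrum (𝓞 K), ((3 : ℕ) : 𝓞 K) ∈ v.asIdeal →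
      Finite (selmerAcBase (W.baseChange K) 3 v ∅))
    (hfin' : ∀ v : HeightOneSpectrum (𝓞 K), ((3 : ℕ) : 𝓞 K) ∈ v.asIdeal →
      Finite (selmerAcBase (W'.baseChange K) 3 v ∅)) :
    ∃ (T : Finset (HeightOneSpectrum (𝓞 K))) (c : HeightOneSpectrum (𝓞 K) → ℕ),
      (↑T = {v : HeightOneSpectrum (𝓞 K) | ((3 : ℕ) : 𝓞 K) ∉ v.asIdeal ∧
        (¬ (W.baseChange K).HasGoodReductionAt v ∨ ¬ (W'.baseChange K).HasGoodReductionAt v)}) ∧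
      (∀ v ∈ T, (∃ d₀ : decomp (K := K) v, (κ (d₀ : absoluteGaloisGroup K)).toAdd = (3 : ℤ_[3]) ^ c v) ∧
        ∀ d : decomp (K := K) v, (3 : ℤ_[3]) ^ c v ∣ (κ (d : absoluteGaloisGroup K)).toAdd) ∧
      Module.IsTorsion (IwasawaAlgebra 3) (XAc (W'.baseChange K) 3 κ 𝔭' ∅ γ) ∧
      ∃ g' : UnrSeries 3,
        (XAc.charIdeal (W'.baseChange K) 3 κ 𝔭' ∅ γ).map (PowerSeries.map (Halves.toUnr 3)) =
            Ideal.span {g'} ∧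
          (∀ i < lambdaInvariant 3 (XAc (W'.baseChange K) 3 κ 𝔭' ∅ γ),
            ‖((PowerSeries.coeff i g' : unrIntegers 3) : ℂ_[3])‖ < 1) ∧
          ‖((PowerSeries.coeff (lambdaInvariant 3 (XAc (W'.baseChange K) 3 κ 𝔭' ∅ γ)) g' :
            unrIntegers 3) : ℂ_[3])‖ = 1 ∧
          3 ^ n *
              ∏ v ∈ T, Nat.card {f : subgroupH1 (kerD κ v) ((W.baseChange K).geomPrimaryTorsion 3) //
                3 • f = 0} ^ (3 ^ c v) =
            3 ^ lambdaInvariant 3 (XAc (W'.baseChange K) 3 κ 𝔭' ∅ γ) *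
              ∏ v ∈ T, Nat.card {f : subgroupH1 (kerD κ v) ((W'.baseChange K).geomPrimaryTorsion 3) //
                3 • f = 0} ^ (3 ^ c v) := by
  haveI : Fact (Nat.Prime 3) := ⟨Nat.prime_three⟩
  -- `Σ` and its finiteness / decomposition data
  set S : Set (HeightOneSpectrum (𝓞 K)) := {v | ((3 : ℕ) : 𝓞 K) ∉ v.asIdeal ∧
    (¬ (W.baseChange K).HasGoodReductionAt v ∨ ¬ (W'.baseChange K).HasGoodReductionAt v)} with hSdef
  have hSfin : S.Finite := by
    refine (((W.baseChange K).finite_badPlaces_holds (𝓞 K)).union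
      ((W'.baseChange K).finite_badPlaces_holds (𝓞 K))).subset fun v hv ↦ ?_
    rcases hv.2 with h | h
    · exact Or.inl h
    · exact Or.inr h
  have hSp : ∀ v ∈ S, ((3 : ℕ) : 𝓞 K) ∉ v.asIdeal := fun v hv ↦ hv.1
  have hSdec : ∀ v ∈ S, ¬ (decomp v ≤ κ.kerSubgroup) := by
    intro v hv
    rcases hv.2 with h | h
    · exact not_decomp_le_kerSubgroup_of_not_hasGoodReductionAt_baseChange W hN K hK hHe (by decide) κ
        hκ hv.1 h
    · exact not_decomp_le_kerSubgroup_of_not_hasGoodReductionAt_baseChange W' hN' K hK hHe' (by decide)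
        κ hκ hv.1 h
  choose! c hc₀ hc hle using fun v (hv : v ∈ S) ↦ exists_pow_and_forall_dvd_of_not_le κ v (hSdec v hv)
  -- arithmetic of the datum
  have hadd : Addv W 3 := hO6.2.1
  have hpN : 3 ∣ W.conductorNorm ℤ :=
    (W.dvd_conductorNorm_iff_not_hasGoodReductionAtPrime 3).mpr hadd.1
  have hsplit : SplitsIn K 3 := hHe 3 (Fact.out) (hN ▸ hpN)
  obtain ⟨he', hf'⟩ := degreeOne_of_splitsIn hK.1 hsplit h𝔭'
  have h4' : ∀ R : (W'.baseChange ℚ_[3]).toAffine.Point, 3 • R = 0 → R = 0 :=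
    (baseChange_noPTorsion_iff_of_modPCongruent 3 W W' ℚ_[3] hcong).mp h4
  have hnf := forall_finite_eq_bot_baseChange_of_noPTorsionPadic W 3 h4 hPT hPT2 hK hsplit κ γ h𝔭'
    he' hf' hfin
  have hnf' := forall_finite_eq_bot_baseChange_of_noPTorsionPadic W' 3 h4' hPT hPT2 hK hsplit κ γ h𝔭'
    he' hf' hfin'
  -- `Sel^Σ[3]` of the wild curve is finite (source side, from `μ = 0` at `Σ = ∅`)
  haveI := XAc.module_finite κ 𝔭' (∅ : Set (HeightOneSpectrum (𝓞 K))) γ Set.finite_empty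
    (W := W.baseChange K)
  have hμe : muInvariant 3 (XAc (W.baseChange K) 3 κ 𝔭' ∅ γ) = 0 :=
    muInvariant_eq_zero_of_map_charIdeal_eq_span (XAc (W.baseChange K) 3 κ 𝔭' ∅ γ) hT hg ⟨n, hn.2⟩
  have hfine : Set.Finite {s : selmerAc (W.baseChange K) 3 κ 𝔭' ∅ | 3 • s = 0} :=
    finite_pTorsion_of_muInvariant_eq_zero (W.baseChange K) 3 κ 𝔭' ∅ γ hT hμe
  have hfinS : Set.Finite {s : selmerAc (W.baseChange K) 3 κ 𝔭' S | 3 • s = 0} :=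
    finite_selmerAc_pTorsion_of_empty (W.baseChange K) κ hSfin hSp hSdec hfine
  -- the assembled algebraic half (twin torsion + `μ = 0`), then `Sel^Σ[3]` of the twin is finite
  obtain ⟨hT', g', hg', hglt', hgeq', hcount⟩ := defectTransport_algebraicHalf W W' K hO6 hN hcong hN'
    hK hHe hHe' κ hκ γ h𝔭' hT hg hn h4 hnf hnf'
  haveI := XAc.module_finite κ 𝔭' (∅ : Set (HeightOneSpectrum (𝓞 K))) γ Set.finite_empty
    (W := W'.baseChange K)
  have hμ'e : muInvariant 3 (XAc (W'.baseChange K) 3 κ 𝔭' ∅ γ) = 0 :=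
    muInvariant_eq_zero_of_map_charIdeal_eq_span (XAc (W'.baseChange K) 3 κ 𝔭' ∅ γ) hT' hg'
      ⟨_, hgeq'⟩
  have hfin'e : Set.Finite {s : selmerAc (W'.baseChange K) 3 κ 𝔭' ∅ | 3 • s = 0} :=
    finite_pTorsion_of_muInvariant_eq_zero (W'.baseChange K) 3 κ 𝔭' ∅ γ hT' hμ'e
  have hfin'S : Set.Finite {s : selmerAc (W'.baseChange K) 3 κ 𝔭' S | 3 • s = 0} :=
    finite_selmerAc_pTorsion_of_empty (W'.baseChange K) κ hSfin hSp hSdec hfin'e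
  -- the two local products (GV Cor. (2.3) + (2.10) over `K_∞`)
  have hprod := natCard_quotient_pTorsion_baseChange_eq_prod_of_noPTorsionPadic W 3 h4 hPT hPT2 hK
    hsplit κ γ h𝔭' he' hf' hfin hSfin hSp c hc hle hfinS
  have hprod' := natCard_quotient_pTorsion_baseChange_eq_prod_of_noPTorsionPadic W' 3 h4' hPT hPT2 hK
    hsplit κ γ h𝔭' he' hf' hfin' hSfin hSp c hc hle hfin'S
  refine ⟨hSfin.toFinset, c, hSfin.coe_toFinset, fun v hv ↦ ?_, hT', g', hg', hglt', hgeq', ?_⟩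
  · exact ⟨hc₀ v (hSfin.mem_toFinset.mp hv), hle v (hSfin.mem_toFinset.mp hv)⟩
  · rw [← hprod, ← hprod']
    exact hcount

end Summit.BirchSwinnertonDyer.BirchSwinnertonDyer.Theorems.UniversalToricDescentDefectTransport

end
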